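import Literature.IUT.LogThetaLattice.StripFrameOfKits
import Literature.IUT.LogThetaLattice.UnitMuCoricFrame
import Literature.IUT.LogThetaLattice.LogThetaLatticeCoricityProofs

/-!
# The frame-level residual `R` ([IUTchII] Cor 4.10 (iv) / [IUTchIII] Thm 1.5 (ii) / Thm 2.2 (i)) on the REAL frame `StripFrame.ofKits`

Proof-only bridge (abc-iut cell, wave-4 seat abc-iut-w4-d028; no new definitions; v2/v3 = doc-only (quotation
discipline §F v1.12 (1) + provenance note L6t22g7-N1), declarations unchanged; over abc-iut-L6-t3's
`StripFrameOfKits` and this seat's `UnitMuCoricFrame`, imported unchanged). S. Mochizuki, *Inter-universal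
Teichmüller theory II*, kurims Dec-2020 manuscript, Cor 4.10 (iv) p.160, Def 4.9 (vi)–(viii) pp.157–158
[cite: Mochizuki2012, Cor 4.10 (iv) p.160]; *III*, kurims May-2020 manuscript, Thm 1.5 (ii) p.48, Thm 2.2 (i) p.65.
Claim key DISPUTED (D-0012): nothing here asserts a disputed claim or takes a side on [IUTchIII] Cor 3.12.

`UnitMuCoricFrame` reduced the three tree copies of "`(−)F^{⊢×μ}_△` is an invariant" — `HodgeTheaterStrips.UnitMuCoric`
([IUTchII] Cor 4.10 (iv), FACT-LIST F-2065), `ThetaLinkData.induced_full` ([IUTchIII] Thm 1.5 (ii)),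
`ThetaMonoidData.mapAut_surjective` ([IUTchIII] Thm 2.2 (i)) — to ONE property of a strip frame `S`,
`R(S) :≡ ∀ X Y : S.Fglxm, (PolyIso.full X Y).map S.FglxmToFxm = PolyIso.full _ _`. abc-iut-L6-t3's
`StripFrame.ofKits L hbij hsurj hR X` (MERGE-MAP B10 part 2) is THE real frame, assembled from the [IUTchI] kits and an
[IUTchII] Def 4.9 input `X : TimesMuSide FK L` whose categories are wrapped in `AsSmall`. This file transports `R`
through that assembly:

* `TimesMuSide.induced_full_of_mapIso_surjective` — at the kit level, iso-surjectivity of the input's composite gives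
  the `induced_full` field of abc-iut-L6-t3's `ThetaLinkKit X` for any pilots (so that field is dischargeable);
* `StripFrame.ofKits_fglxmToFxm_mapIso_surjective` — if the input's composite `X.FglxmToFvtxm ⋙ X.FvtxmToFxm`
  (`F^{⊩▶×μ} ↦ F^{⊢▶×μ} ↦ F^{⊢×μ}`) is surjective on isomorphisms, so is `(StripFrame.ofKits …).FglxmToFxm` (transport
  along `AsSmall`, abc-iut-L6-t3's `liftF_mapIso_surjective`);
* `StripFrame.ofKits_map_full_fglxmToFxm` — hence `R(StripFrame.ofKits …)`;
* hence on the real frame: **`StripFrame.ofKits_unitMuCoric`** (Cor 4.10 (iv) `UnitMuCoric` for EVERY pair of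
  Hodge-theater strips over the frame-induced setting), **`StripFrame.ofKits_mapAut_surjective`** (the Thm 2.2 (i)
  field shape `Aut_{F^{⊩▶×μ}}(A) ↠ Aut_{F^{⊢×μ}}(A)` for every `A`) and **`StripFrame.ofKits_induced_full`** (the Thm 1.5 (ii)
  field shape for ANY pair of pilot functors) — all from the ONE hypothesis on the input `X`;
* **`StripFrame.ofKits_exists_thetaLinkData`** — hence abc-iut-L6-t3's [IUTchIII] Thm 1.5 (ii) interface
  `ThetaLinkData (StripFrame.ofKits …)` is INSTANTIABLE on the real frame with ANY prescribed pilot functors and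
  unit-portion isomorphisms ([IUTchII] Cor 4.10 (i)–(iii)), its axiom `induced_full` being a THEOREM there
  (abc-iut-w4-d018's `exists_thetaLinkData_of_map_full`).
For the print-level split groupoids of abc-iut-L6-t2 (`FVdashSplitTriMuPrimeStrip ⥤ FSplitTriMuPrimeStrip ⥤
FTimesMuPrimeStrip`, Def 4.9 (iii)/(iv)/(vii)/(viii): `O^{▶×μ} = O^▶ × O^{×μ}`) that hypothesis is proved at the
`F^{⊢▶×μ} ↦ F^{⊢×μ}` step by abc-iut-L6-t2's landed `FSplitTriMuPrimeStrip.mapIso_surjective_of_model` (kit rule) and,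
through the realified `F^{⊩▶×μ}`-level, by this seat's LANDED `HodgeArakelov/RealifiedPrimeStripSplitMuLift`
(`FVdashSplitTriMuPrimeStrip.mapAut_toTimesMu_surjective`, `map_full_toTimesMu_of_model`; over abc-iut-L6-t2's
`RealifiedPrimeStripSplitCategories`; v3 of this docstring records that landing — L6-t22 note N1 closed); for the
`O^▷`-level groupoids it FAILS
in general (`HodgeArakelov/LocalTriMuDataIsoSurjectivityWitness`). GAP-LEDGER row G-w4d028-1.
Typed ≠ discharged: `hbij`/`hsurj`/`hR` ([IUTchI] Cor 5.3 (ii)(iii), Rmk 5.2.1 (ii)) remain the frame's named hypotheses.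
-/

namespace Literature.IUT.LogThetaLattice

open CategoryTheory
open Literature.IUT.HodgeTheaters Literature.IUT.HodgeTheaters.PMBaseKit
open Literature.IUT.HodgeArakelov
open AsSmallTransport

universe u

variable {l : ℕ} {K : PMBaseKit.{u} l} {M : K.MultKit} {FK : K.FKit M} (L : FK.MonoLaws)
  (hbij : FK.IsomFtoDBijective) (hsurj : FK.IsomFmtoDmSurjective) (hR : FK.RlfOfIsStrip) (X : TimesMuSide FK L)

/-- **IUTchII:Cor4.10(iv)** (kurims p.160) AT THE KIT LEVEL: if the Def 4.9 input's composite
`F^{⊩▶×μ} ↦ F^{⊢▶×μ} ↦ F^{⊢×μ}` is surjective on `Isom(A, B)` for all `A`, `B`, then for ANY pair of pilot functors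
`P`, `Q` into `X.Fglxm` (e.g. the fields `pilotTheta k`, `pilotDelta` of abc-iut-L6-t3's `ThetaLinkKit X`) the image of
the full poly-isomorphism is the full poly-isomorphism — the `induced_full` field of `ThetaLinkKit` is then a
theorem, not an input. [claim: Mochizuki2012, status: disputed] -/
theorem TimesMuSide.induced_full_of_mapIso_surjective
    (h : ∀ A B : X.Fglxm, Function.Surjective (fun g : A ≅ B => (X.FglxmToFvtxm ⋙ X.FvtxmToFxm).mapIso g))
    {C : Type*} [Category C] (P Q : C ⥤ X.Fglxm) (H H' : C) :
    (PolyIso.full (P.obj H) (Q.obj H')).map (X.FglxmToFvtxm ⋙ X.FvtxmToFxm) = PolyIso.full _ _ :=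
  (mapIso_surjective_iff_map_full _ _ _).mp (h _ _)

/-- **IUTchII:Cor4.10(iv)** (kurims p.160) TRANSPORT: if the [IUTchII] Def 4.9 input's composite
`F^{⊩▶×μ} ↦ F^{⊢▶×μ} ↦ F^{⊢×μ}` is surjective on `Isom(A, B)` for all `A`, `B`, then so is `FglxmToFxm` of the assembled
real frame `StripFrame.ofKits` (the `AsSmall` wrapping changes nothing: abc-iut-L6-t3's `liftF_mapIso_surjective`).
[claim: Mochizuki2012, status: disputed] -/
theorem StripFrame.ofKits_fglxmToFxm_mapIso_surjective
    (h : ∀ A B : X.Fglxm, Function.Surjective (fun g : A ≅ B => (X.FglxmToFvtxm ⋙ X.FvtxmToFxm).mapIso g))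
    (A B : (StripFrame.ofKits L hbij hsurj hR X).Fglxm) :
    Function.Surjective
      (fun f : A ≅ B => (StripFrame.ofKits L hbij hsurj hR X).FglxmToFxm.mapIso f) :=
  liftF_mapIso_surjective (X.FglxmToFvtxm ⋙ X.FvtxmToFxm) h A B

/-- **IUTchII:Cor4.10(iv)** (kurims p.160) hence the frame-level residual `R` HOLDS on the real frame: `FglxmToFxm`
carries the full poly-isomorphism between any two `F^{⊩▶×μ}`-prime-strips onto the full poly-isomorphism of
`F^{⊢×μ}`-prime-strips ("coincides with the full poly-isomorphism"). [claim: Mochizuki2012, status: disputed] -/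
theorem StripFrame.ofKits_map_full_fglxmToFxm
    (h : ∀ A B : X.Fglxm, Function.Surjective (fun g : A ≅ B => (X.FglxmToFvtxm ⋙ X.FvtxmToFxm).mapIso g))
    (A B : (StripFrame.ofKits L hbij hsurj hR X).Fglxm) :
    (PolyIso.full A B).map (StripFrame.ofKits L hbij hsurj hR X).FglxmToFxm = PolyIso.full _ _ :=
  (mapIso_surjective_iff_map_full _ A B).mp
    (StripFrame.ofKits_fglxmToFxm_mapIso_surjective L hbij hsurj hR X h A B)

/-- **IUTchII:Cor4.10(iv)** (kurims p.160) "`(−)F^{⊢×μ}_△` is an invariant of both the `Θ^{×μ}`- and `Θ^{×μ}_{gau}`-links" —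
abc-iut-L6-t2's named statement `HodgeTheaterStrips.UnitMuCoric` (FACT-LIST F-2065) — for EVERY pair of Hodge-theater
strips over the setting induced by the REAL frame `StripFrame.ofKits`, from the one hypothesis on the Def 4.9 input.
[claim: Mochizuki2012, status: disputed] -/
theorem StripFrame.ofKits_unitMuCoric
    (h : ∀ A B : X.Fglxm, Function.Surjective (fun g : A ≅ B => (X.FglxmToFvtxm ⋙ X.FvtxmToFxm).mapIso g))
    (dag ddag : HodgeTheaterStrips (ThetaLinkSetting.ofStripFrame (StripFrame.ofKits L hbij hsurj hR X))) :
    dag.UnitMuCoric ddag :=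
  dag.unitMuCoric_of_map_full ddag (StripFrame.ofKits_map_full_fglxmToFxm L hbij hsurj hR X h)

/-- **IUTchIII:Thm2.2(i)** (kurims p.65) "the second arrows in each line are surjections" — the field shape
`ThetaMonoidData.mapAut_surjective` — on the REAL frame `StripFrame.ofKits`, for every `F^{⊩▶×μ}`-prime-strip, from
the one hypothesis on the Def 4.9 input. [claim: Mochizuki2012, status: disputed] -/
theorem StripFrame.ofKits_mapAut_surjective
    (h : ∀ A B : X.Fglxm, Function.Surjective (fun g : A ≅ B => (X.FglxmToFvtxm ⋙ X.FvtxmToFxm).mapIso g))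
    (A : (StripFrame.ofKits L hbij hsurj hR X).Fglxm) :
    Function.Surjective ((StripFrame.ofKits L hbij hsurj hR X).FglxmToFxm.mapAut A) :=
  (map_full_iff_mapAut_surjective (S := StripFrame.ofKits L hbij hsurj hR X)).mp
    (StripFrame.ofKits_map_full_fglxmToFxm L hbij hsurj hR X h) A

/-- **IUTchIII:Thm1.5(ii)** (kurims p.48) the field shape `ThetaLinkData.induced_full` ("The horizontal arrows of the
Gaussian log-theta-lattice induce full poly-isomorphisms between the respective associated `F^{⊢×μ}`-prime-strips
[…]", p.48) on the REAL frame `StripFrame.ofKits`, for ANY pair of pilot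
functors `†HT ↦ †F^{⊩▶×μ}_{env/gau}`, `‡HT ↦ ‡F^{⊩▶×μ}_△` ([IUTchII] Cor 4.10 (i)/(ii)), from the one hypothesis on the
Def 4.9 input. [claim: Mochizuki2012, status: disputed] -/
theorem StripFrame.ofKits_induced_full
    (h : ∀ A B : X.Fglxm, Function.Surjective (fun g : A ≅ B => (X.FglxmToFvtxm ⋙ X.FvtxmToFxm).mapIso g))
    (P Q : (StripFrame.ofKits L hbij hsurj hR X).HT ⥤ (StripFrame.ofKits L hbij hsurj hR X).Fglxm)
    (Y Z : (StripFrame.ofKits L hbij hsurj hR X).HT) :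
    (PolyIso.full (P.obj Y) (Q.obj Z)).map (StripFrame.ofKits L hbij hsurj hR X).FglxmToFxm = PolyIso.full _ _ :=
  induced_full_of_map_full (StripFrame.ofKits_map_full_fglxmToFxm L hbij hsurj hR X h) P Q Y Z

/-- **IUTchIII:Thm1.5(ii)** (kurims p.48) NON-VACUITY ON THE REAL FRAME: given ANY functorial pilots
`†HT ↦ †F^{⊩▶×μ}_△`, `†HT ↦ †F^{⊩▶×μ}_{env/gau}` and unit-portion isomorphisms ([IUTchII] Cor 4.10 (i)–(iii)) over
`StripFrame.ofKits`, abc-iut-L6-t3's interface `ThetaLinkData` is inhabited with these pilots — its axiom `induced_full`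
([IUTchII] Cor 4.10 (iv) / Thm 1.5 (ii)) PROVED from the one hypothesis on the Def 4.9 input (abc-iut-w4-d018's
`exists_thetaLinkData_of_map_full` + `StripFrame.ofKits_map_full_fglxmToFxm`). [claim: Mochizuki2012, status: disputed] -/
theorem StripFrame.ofKits_exists_thetaLinkData
    (h : ∀ A B : X.Fglxm, Function.Surjective (fun g : A ≅ B => (X.FglxmToFvtxm ⋙ X.FvtxmToFxm).mapIso g))
    (pilotDelta : (StripFrame.ofKits L hbij hsurj hR X).HT ⥤ (StripFrame.ofKits L hbij hsurj hR X).Fglxm)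
    (pilotTheta : LatticeKind →
      ((StripFrame.ofKits L hbij hsurj hR X).HT ⥤ (StripFrame.ofKits L hbij hsurj hR X).Fglxm))
    (unitPortion : ∀ k : LatticeKind,
      pilotDelta ⋙ (StripFrame.ofKits L hbij hsurj hR X).FglxmToFxm ≅
        pilotTheta k ⋙ (StripFrame.ofKits L hbij hsurj hR X).FglxmToFxm) :
    ∃ T : ThetaLinkData (StripFrame.ofKits L hbij hsurj hR X),
      T.pilotDelta = pilotDelta ∧ T.pilotTheta = pilotTheta ∧
        T.fxmDelta = pilotDelta ⋙ (StripFrame.ofKits L hbij hsurj hR X).FglxmToFxm :=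
  exists_thetaLinkData_of_map_full pilotDelta pilotTheta unitPortion
    (StripFrame.ofKits_map_full_fglxmToFxm L hbij hsurj hR X h)

end Literature.IUT.LogThetaLattice
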